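import Summits.BirchSwinnertonDyer.BirchSwinnertonDyer.Theorems.ThetaPartnerAtTwoSignedMainConjectureCMTwoRankZeroOfPubOfFlatOfStubsV20
import Summits.BirchSwinnertonDyer.BirchSwinnertonDyer.Theorems.ThetaPartnerAtTwoSignedMainConjectureCMTwoRankZeroOfPubOfFlatStubPoitouTateDeepTwo
import HarnessLib

/-!
# Route `ThetaPartnerAtTwo` (TP2), crux K2R0P♭ `SignedMainConjectureCMTwoRankZeroOfPubOfFlat` (stmt-BirchSwinnertonDyer-26471), line `rankzero` v21 —
# the ONE-HYPOTHESIS certificate: K2R0P♭ BY NAME from KZ alone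

HONEST FRAMING (cell `pub/bsd-wall`, W-ALL row 1 TP2 K2 column; lead prover `bsd-wall-tp2-p2` g11; `--supports` only). THEOREM ONLY,
CONDITIONAL on ONE displayed hypothesis `hKZ` = the registered stub `stub_zetaErlKSideCMTwo` of skeleton `rankzero` v21 VERBATIM (= crux
workfile `KZText.lean`, `KZText`; PUB-shaped: Kato 2004 Thm. 12.5 / Prop. 15.9 / (15.12.2) / Lemma 15.13 / §15.15 / (15.16.1) for the CM newform
`f_A` at `p = 2`, Kobayashi 2003 (8.23), Johnson-Leung–Kings 2011 Thm. 5.7 / §7.2). It is the composition certificate p632409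
(`signedMainConjectureCMTwoRankZeroOfPubOfFlat_of_poitouTateDeepTwo_of_zetaErlKSide`, two hypotheses) with its first hypothesis (S_PT)
DISCHARGED by the landed registered stub `Cruxes.SignedMainConjectureCMTwoRankZeroOfPubOfFlat.RankZero.stub_poitouTateDeepTwo` (p636500; kernel
route: Kőnig double tower + Rubin B.2.3 + Milne I 4.10 (b) levelwise via Shapiro, Poitou–Tate itself the tree theorem
`SchneiderFreeAdditiveX3.PoitouTateReduction.poitouTate_selmerStructure_duality_real_holds ℚ`). So the residual of 26471 is EXACTLY `hKZ`:
the pen's re-key «KZ ∧ PUB → FLAT → body» closes by `fun hKZ ↦ signedMainConjectureCMTwoRankZeroOfPubOfFlat_of_zetaErlKSide hKZ`.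
Closes no item; credits nothing; 26471 is NOT closed by this; BSD is NOT proved by any of this.

References: [Kato2004Asterisque] Thm. 12.5 (p. 222), Prop. 15.9, Lemma 15.13, §15.15, (15.16.1) (pp. 258–265); [Kobayashi2003] (8.23), Thm. 7.3 (ii);
[JohnsonLeungKings2011] Thm. 5.7, §7.2; [PollackRubin2004] Thm. 7.3; [MilneADT2006] I Thm. 4.10.
-/

set_option autoImplicit false
set_option linter.dupNamespace false

noncomputable section

open scoped Classical NumberField MatrixGroups ModularForm

open NumberField IsDedekindDomain CongruenceSubgroup WeierstrassCurve Literature Literature.NumberTheory.EllipticCurves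
  Literature.NumberTheory.GaloisRepresentations Literature.NumberTheory.EllipticCurves.ModularForms
  Literature.NumberTheory.EllipticCurves.Rank1Residual Literature.NumberTheory.EllipticCurves.IwasawaDual
  Literature.NumberTheory.EllipticCurves.Kobayashi2003 Literature.NumberTheory.EllipticCurves.Module
  Literature.NumberTheory.EllipticCurves.Kato2004 Literature.NumberTheory.EllipticCurves.Kato2004.EulerSystemValues
  Literature.NumberTheory.EllipticCurves.GreenbergSelmer Literature.NumberTheory.EllipticCurves.Sprung2012
  ZpExtension Summit.BirchSwinnertonDyer.Rank1Residual.Supersingular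
  Summit.BirchSwinnertonDyer.BirchSwinnertonDyer.Theorems.SignedKatoOffTwo

namespace Summit.BirchSwinnertonDyer.BirchSwinnertonDyer.Theorems.SignedLowerOffTwo

/-- **K2R0P♭ BY NAME from KZ alone** (= p632409 ∘ p636500: the (S_PT) hypothesis of the v20 composition certificate is the landed
registered stub `stub_poitouTateDeepTwo`). CONDITIONAL on `hKZ` only = the registered stub `stub_zetaErlKSideCMTwo` verbatim.
[cite: Kato2004Asterisque, Thm. 12.5 (p. 222), Prop. 15.9, Lemma 15.13, (15.16.1) (pp. 258–265)] [cite: Kobayashi2003, (8.23) (p. 18), Thm. 7.3 (ii)]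
[cite: JohnsonLeungKings2011, Thm. 5.7 and §7.2] -/
theorem signedMainConjectureCMTwoRankZeroOfPubOfFlat_of_zetaErlKSide
    (hKZ :
    ∀ (v : HeightOneSpectrum (𝓞 ℚ)), ((2 : ℕ) : 𝓞 ℚ) ∈ v.asIdeal →
      ∀ (A : WeierstrassCurve ℚ) [A.IsElliptic] [A.IsGloballyMinimal],
        A.HasCM → A.analyticRank = 0 → GoodSS A 2 → A.frobeniusTrace 2 = 0 →
        2 ∣ A.shaOrder * A.tamagawaProduct →
        ∀ (κ : ZpExtension ℚ 2) (γ : Field.absoluteGaloisGroup ℚ),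
          κ.IsCyclotomic → κ.IsTopGenerator γ → IsCyclotomicVariable 2 γ →
        ∀ [NeZero (A.conductorNorm ℤ)] (f : CuspForm (Gamma0 (A.conductorNorm ℤ)) 2),
          IsNewformOf A f → ∀ (ϖ : ℚ), (ϖ : ℝ) * A.realPeriodRat = plusPeriod f →
        ∀ (Lplus Lminus : IwasawaAlgebra 2), IsPollackPair f 2 Lplus Lminus →
        ∀ [ContinuousSMul ℤ_[2] (A.tateModule 2)] (Y : A.FineSelmerDualData κ γ),
        ∀ 𝔭' : PrimeSpectrum (IwasawaAlgebra 2), 𝔭'.asIdeal.height = 1 →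
          PowerSeries.C (2 : ℤ_[2]) ∉ 𝔭'.asIdeal →
        ∀ (I : Kato2004.IwasawaH1Data A 2 κ γ)
          (pair : ∀ n : ℕ, H1 (tateRep A 2) (κ.layerSubgroup n) →ₗ[ℤ_[2]]
            (localLayerPointsOfEmb κ (closureEmb (K := ℚ) (v.adicCompletion ℚ)) A n →+ ℤ_[2])),
          -- (P1) projection formula
          (∀ (n : ℕ) (x : H1 (tateRep A 2) (κ.layerSubgroup (n + 1))) (Q : localPoints A (v.adicCompletion ℚ))
            (hQ : Q ∈ localLayerPointsOfEmb κ (closureEmb (K := ℚ) (v.adicCompletion ℚ)) A n),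
            pair n (layerCores (tateRep A 2) κ n x) ⟨Q, hQ⟩ =
              pair (n + 1) x ⟨Q, localLayerPointsOfEmb_mono κ (closureEmb (K := ℚ) (v.adicCompletion ℚ)) A (Nat.le_succ n) hQ⟩) →
          -- (P2) Galois invariance, for EVERY `g ∈ Γ_v`
          (∀ (n : ℕ) (g : Field.absoluteGaloisGroup (v.adicCompletion ℚ)) (y : H1 (tateRep A 2) (κ.layerSubgroup n))
            (Q : localPoints A (v.adicCompletion ℚ))
            (hQ : Q ∈ localLayerPointsOfEmb κ (closureEmb (K := ℚ) (v.adicCompletion ℚ)) A n),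
            pair n (conjMap (tateRep A 2).toTopRep (κ.layerSubgroup n) (resGalOfEmb (closureEmb (K := ℚ) (v.adicCompletion ℚ)) g) 1 y)
              ⟨g • Q, smul_mem_localLayerPointsOfEmb κ (closureEmb (K := ℚ) (v.adicCompletion ℚ)) A n g hQ⟩ = pair n y ⟨Q, hQ⟩) →
          -- (P3) residue clause: `pair` IS the `T₂A`-adic local Tate pairing (THE Weil pairings of the tree)
          (∀ (n k : ℕ) (x : H1 (tateRep A 2) (κ.layerSubgroup n))
            (Q : localLayerPointsOfEmb κ (closureEmb (K := ℚ) (v.adicCompletion ℚ)) A n),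
            PadicInt.toZModPow k (pair n x Q) =
              LayerPairing.layerPairingPk A κ v (LayerPairing.weilTowerPk A) (LayerPairing.weilTowerPk_pow A)
                (LayerPairing.weilTowerPk_add_left A) (LayerPairing.weilTowerPk_add_right A) (LayerPairing.weilTowerPk_smul A)
                n k x Q) →
        ∃ (g : Field.absoluteGaloisGroup (v.adicCompletion ℚ))
          (_ : κ.IsTopGenerator (resGalOfEmb (closureEmb (K := ℚ) (v.adicCompletion ℚ)) g))
          (d : ℕ → localPoints A (v.adicCompletion ℚ)) (s : I.H),
          (∀ n, d n ∈ localLayerPointsOfEmb κ (closureEmb (K := ℚ) (v.adicCompletion ℚ)) A n) ∧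
          (∀ n, localTraceOfEmb κ (closureEmb (K := ℚ) (v.adicCompletion ℚ)) A (n + 1) (n + 2) (d (n + 2)) = -d n) ∧
          (∀ n : ℕ, 1 ≤ n → ∀ P ∈ localLayerPointsOfEmb κ (closureEmb (K := ℚ) (v.adicCompletion ℚ)) A n,
            ∃ B ∈ AddSubgroup.closure (Set.range fun σ : Field.absoluteGaloisGroup (v.adicCompletion ℚ) ↦ σ • d n),
              ∃ P' ∈ localLayerPointsOfEmb κ (closureEmb (K := ℚ) (v.adicCompletion ℚ)) A (n - 1),
              ∃ R ∈ localLayerPointsOfEmb κ (closureEmb (K := ℚ) (v.adicCompletion ℚ)) A n, P = B + P' + 2 • R) ∧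
          (∀ P ∈ localLayerPointsOfEmb κ (closureEmb (K := ℚ) (v.adicCompletion ℚ)) A 0,
            ∃ a : ℤ, ∃ R ∈ localLayerPointsOfEmb κ (closureEmb (K := ℚ) (v.adicCompletion ℚ)) A 0, P = a • d 0 + 2 • R) ∧
          -- (ERL_pair) ON THE layer pairings: `ν·P_{n,d_n}(pair n (I.proj n s)) ≡ μ·θ_n (mod ω_n)` in `Λ ⊗ ℚ₂`, `μ, ν ∉ 𝔭'`
          (∃ μ ν : IwasawaAlgebra 2, μ ∉ 𝔭'.asIdeal ∧ ν ∉ 𝔭'.asIdeal ∧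
            ∀ n : ℕ, ∃ (m : ℕ) (q : IwasawaAlgebra 2),
              PowerSeries.C ((2 : ℚ_[2]) ^ m) *
                  (iwasawaToPowerSeries 2 μ * ((mazurTateElement f 2 n).map (algebraMap ℚ ℚ_[2]) : PowerSeries ℚ_[2]) -
                    iwasawaToPowerSeries 2 (ν * pairingSum A (localLayerPointsOfEmb κ (closureEmb (K := ℚ) (v.adicCompletion ℚ)) A n)
                      g n (d n) (pair n (I.proj n s)))) =
                iwasawaToPowerSeries 2 (((cyclotomicOmega 2 n).map (Int.castRingHom ℤ_[2]) : PowerSeries ℤ_[2]) * q)) ∧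
          -- (g)^ι REPLACED by its typed K-side input: ONE K-side datum (tower + JLK §7.2 + §15.1 + transport socket)
          Nonempty (Summit.BirchSwinnertonDyer.BirchSwinnertonDyer.Theorems.KatoDescent.KSideDatum I Y s 𝔭')) :
    Summit.BirchSwinnertonDyer.BirchSwinnertonDyer.Theses.ThetaPartnerAtTwo.SignedMainConjectureCMTwoRankZeroOfPubOfFlat :=
  signedMainConjectureCMTwoRankZeroOfPubOfFlat_of_poitouTateDeepTwo_of_zetaErlKSide
    Summit.BirchSwinnertonDyer.BirchSwinnertonDyer.Cruxes.SignedMainConjectureCMTwoRankZeroOfPubOfFlat.RankZero.stub_poitouTateDeepTwo hKZ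

end Summit.BirchSwinnertonDyer.BirchSwinnertonDyer.Theorems.SignedLowerOffTwo

end
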